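import Literature.MathematicalPhysics.QuantumFieldTheory.Balaban1983to89.B6BlockDecayGLapBridgeV1

/-!
# `Balaban1983to89.B6LapCommutesGradV1` — T. Bałaban, *Propagators and renormalization transformations for lattice gauge theories. II*,
# Commun. Math. Phys. **96** (1984) 223–250 [Balaban1984PropagatorsII], (2.112)/(2.129) pp. 243–246 and [4] (1.21): ON THE LATTICE THE VECTOR LAPLACIAN
# COMMUTES WITH THE GRADIENT, `Δ∂ = ∂Δ`, HENCE `Δ·(∂H′_jC^{(j)}_ΛH′_j*∂*) = ∂ΔH′_jC^{(j)}_ΛH′_j*∂*` — the first operator of (2.129) composed with `Δ`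
# IS the second: `ΔK₁ = K₂` for the concrete two-scale V1 data

statement-level skeleton of published theorems with citation tags; proofs where landed; nothing here is a claim about the Yang–Mills mass gap

PDF held: `paper:balaban1984-cmp96-propagators-rt-ii` (journal page = PDF page + 222): (2.112) p. 243 [PDF 21], (2.129) p. 246 [PDF 24];
`paper:balaban1984-cmp95-propagators-rt-i` ([4]; journal page = PDF page + 16): (1.21) p. 21.  PRINT (verbatim).  [B6] (2.129) p. 246:
*"⟨J,GJ⟩ = ⟨J,∂H′_jC^{(j)}_ΛH′_j*∂*J⟩ + ⟨(J − ∂ΔH′_jC^{(j)}_ΛH′_j*∂*J), (G̃_j + H_jC̃^{(j)}_ΛH_j*)(J − ∂ΔH′_jC^{(j)}_ΛH′_j*∂*J)⟩"*; [4] (1.21) p. 21: the lattice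
operators `∂`, `∂*`, `Δ`.

CITATION HEADER (lean-in-tree rule) — WHAT IS REPRODUCED.  Phase-2 file of the `lit-balaban` typed skeleton (HOME `run/shared/lean/pub/lit-balaban/`),
seat **p22 gen 15**, lane B6 §C (fold owner r03, referee ref-4); SKELETON rows **B6.Eq2.129-2.131** / **B6.Prop2.5** (cells only).  Second input
(after file 18 `…B6BlockDecayGLapBridgeV1`) of the `ΔGJ` member of [4] (1.110) for the two-scale `G` of (2.90) through (2.129): the purely algebraic
lattice identity **`Lap_comp_dE`** — `(Σ_ν∇_ν*∇_ν)∘∂ = ∂∘Δ` for r03's V1 gradient `dE c` and scalar Laplacian `lapE c` (`= ∂*∂`,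
`LatticeFieldCalculus.laplace`), with the vector Laplacian `Σ_ν∇_ν*∇_ν` in the canonical spelling of files 8–18 (`∇_ν = c(S_ν − I)`,
`∇_ν* = c(S_ν⁻¹ − I)`; unit shifts commute, b04's `shift_shift_comm` / `unshift_shift_comm`) — and its consequence for the concrete data
`…B6SectCTwoScaleV1Lattice.tsV1`: **`Lap_comp_K1`**, `(Σ_ν∇_ν*∇_ν)∘K₁ = K₂` (`K₁ = ∂H′_jC^{(j)}_ΛH′_j*∂*`, `K₂ = ∂ΔH′_jC^{(j)}_ΛH′_j*∂*`, p21's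
`…B6SectCOperators.TwoScaleData.K1/K2`, definitional unfolding), and **`Lap_comp_dE_hP`**: `(Σ_ν∇_ν*∇_ν)∘(∂H′_j) = ∂ΔH′_j` (the factor `T₁ ↦ T₃`
of files 5/8).  IMPORTS BY NAME, restating nothing.  THEOREMS ONLY (no `def`, no `def … : Prop`); standard axioms.  HONEST SCOPE: algebra of the
lattice operators only (no estimate); generic torus `P : Params`, any `c` (the identities need the SAME factor `c` in `Δ` and `∂`); NOT summit progress.
Unit `lit-balaban-p22` (gen 15), 2026-08-22.
-/

noncomputable section

open scoped InnerProductSpace BigOperators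
open Finset

namespace Literature.MathematicalPhysics.QuantumFieldTheory.Balaban1983to89.B6LapCommutesGradV1

open LatticeFieldCalculus B5SectBStatements B5Eq117TorusCarriers B6SectADomainsV1 B6SectAOperatorsV1 B6SectAVectorModelV1 B6SectCOperators
  B6SectCTwoScaleV1 B6SectCTwoScaleV1Lattice B5Eq118OneStroke
open BalabanImbrieJaffe1984to88.BIJ85AxialPropagator411 (BondSpace)
open B6BlockDecayGLapBridgeV1 (Lap_apply)
open B10StarCount (shift_unshift unshift_shift)
open B5Local114G0Second (shift_shift_comm unshift_shift_comm)

variable {P : Params}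

/-- `(∂f)(⟨x, μ⟩) = c(f(x + e_μ) − f(x))` for r03's `dE`. [cite: Balaban1984PropagatorsI, (1.4) p.18] -/
theorem dE_apply' (c : ℝ) (f : ScalarSpace P) (x : Site P 0) (μ : Fin P.d) :
    dE c f ⟨x, μ⟩ = c * (f (x.shift μ) - f x) := by
  rw [dE_apply]
  simp only [grad, PBond.tgt, smul_eq_mul]

/-- `(Δf)(x) = Σ_ν c²(2f(x) − f(x + e_ν) − f(x − e_ν))` for r03's `lapE = ∂*∂`. [cite: Balaban1984PropagatorsI, (1.21) p.21] -/
theorem lapE_apply' (c : ℝ) (f : ScalarSpace P) (x : Site P 0) :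
    lapE c f x = ∑ ν : Fin P.d, c ^ 2 * (2 * f x - f (x.shift ν) - f (x.unshift ν)) := by
  rw [lapE_apply]
  simp only [laplace, smul_eq_mul]
  refine Finset.sum_congr rfl fun ν _ => ?_
  show c ^ 2 * (f x + f x - f (x.shift ν) - f (x.unshift ν)) = _
  ring

/-- **`Δ∂ = ∂Δ` ON THE LATTICE**: the componentwise vector Laplacian `Σ_ν∇_ν*∇_ν` (factor `c`) composed with the gradient `∂` (factor `c`) is the
gradient composed with the scalar Laplacian `Δ = ∂*∂` (unit shifts commute). [cite: Balaban1984PropagatorsI, (1.21) p.21; Balaban1984PropagatorsII, (2.112) p.243 («∂ΔH′_j»)] -/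
theorem Lap_comp_dE (c : ℝ) :
    (∑ ν : Fin P.d, ((c • (onE (LinearMap.funLeft ℝ ℝ (fun b : PBond P 0 => (⟨b.src.unshift ν, b.dir⟩ : PBond P 0))) - LinearMap.id) : BondSpace P →ₗ[ℝ] BondSpace P)) ∘ₗ ((c • (onE (LinearMap.funLeft ℝ ℝ (fun b : PBond P 0 => (⟨b.src.shift ν, b.dir⟩ : PBond P 0))) - LinearMap.id) : BondSpace P →ₗ[ℝ] BondSpace P))) ∘ₗ dE c =
      dE c ∘ₗ lapE c := by
  apply LinearMap.ext
  intro f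
  apply PiLp.ext
  intro b
  obtain ⟨x, μ⟩ := b
  rw [LinearMap.comp_apply, LinearMap.comp_apply, Lap_apply, show (⟨x, μ⟩ : PBond P 0).src = x from rfl,
    show (⟨x, μ⟩ : PBond P 0).dir = μ from rfl]
  simp only [dE_apply', lapE_apply']
  conv_rhs => rw [mul_sub, Finset.mul_sum, Finset.mul_sum, ← Finset.sum_sub_distrib]
  refine Finset.sum_congr rfl fun ν _ => ?_
  rw [← unshift_shift_comm x ν μ, shift_shift_comm x ν μ]
  ring

variable {c : ℝ} (hc : c ≠ 0) {j : ℕ} (Λ' : Finset (Site P (j + 1))) (w : CIdx j Λ' → ℝ)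

/-- **`Δ(∂H′_j) = ∂ΔH′_j`** for the concrete data (`T₁ ↦ T₃` of files 5/8). [cite: Balaban1984PropagatorsII, (2.112) p.243, (2.129) p.246] -/
theorem Lap_comp_dE_hP :
    (∑ ν : Fin P.d, ((c • (onE (LinearMap.funLeft ℝ ℝ (fun b : PBond P 0 => (⟨b.src.unshift ν, b.dir⟩ : PBond P 0))) - LinearMap.id) : BondSpace P →ₗ[ℝ] BondSpace P)) ∘ₗ ((c • (onE (LinearMap.funLeft ℝ ℝ (fun b : PBond P 0 => (⟨b.src.shift ν, b.dir⟩ : PBond P 0))) - LinearMap.id) : BondSpace P →ₗ[ℝ] BondSpace P))) ∘ₗ ((tsV1 hc Λ' w).grad ∘ₗ (tsV1 hc Λ' w).hP) =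
      (tsV1 hc Λ' w).grad ∘ₗ (tsV1 hc Λ' w).lap ∘ₗ (tsV1 hc Λ' w).hP := by
  rw [← LinearMap.comp_assoc, show (tsV1 hc Λ' w).grad = dE c from rfl, Lap_comp_dE c, LinearMap.comp_assoc]
  rfl

/-- **`ΔK₁ = K₂`**: `(Σ_ν∇_ν*∇_ν)∘(∂H′_jC^{(j)}_ΛH′_j*∂*) = ∂ΔH′_jC^{(j)}_ΛH′_j*∂*` for the concrete two-scale data — the first operator of (2.129)
under `Δ` is the second. [cite: Balaban1984PropagatorsII, (2.112) p.243, (2.129) p.246] -/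
theorem Lap_comp_K1 :
    (∑ ν : Fin P.d, ((c • (onE (LinearMap.funLeft ℝ ℝ (fun b : PBond P 0 => (⟨b.src.unshift ν, b.dir⟩ : PBond P 0))) - LinearMap.id) : BondSpace P →ₗ[ℝ] BondSpace P)) ∘ₗ ((c • (onE (LinearMap.funLeft ℝ ℝ (fun b : PBond P 0 => (⟨b.src.shift ν, b.dir⟩ : PBond P 0))) - LinearMap.id) : BondSpace P →ₗ[ℝ] BondSpace P))) ∘ₗ (tsV1 hc Λ' w).K1 = (tsV1 hc Λ' w).K2 := by
  show _ ∘ₗ ((tsV1 hc Λ' w).grad ∘ₗ (tsV1 hc Λ' w).hP ∘ₗ (tsV1 hc Λ' w).C ∘ₗ LinearMap.adjoint (tsV1 hc Λ' w).hP ∘ₗ (tsV1 hc Λ' w).dv) =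
    (tsV1 hc Λ' w).grad ∘ₗ (tsV1 hc Λ' w).lap ∘ₗ (tsV1 hc Λ' w).hP ∘ₗ (tsV1 hc Λ' w).C ∘ₗ LinearMap.adjoint (tsV1 hc Λ' w).hP ∘ₗ (tsV1 hc Λ' w).dv
  rw [← LinearMap.comp_assoc, show (tsV1 hc Λ' w).grad = dE c from rfl, Lap_comp_dE c, LinearMap.comp_assoc]
  rfl

end Literature.MathematicalPhysics.QuantumFieldTheory.Balaban1983to89.B6LapCommutesGradV1

end
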